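import Literature.NumberTheory.ConnesConsani2024.SemilocalTransformGeneralS
import HarnessLib

/-!
# Connes 1999 Thm VII.4, `k = ℚ`, `S = {∞} ∪ P` — OPERATOR ALGEBRA OF THE SEMILOCAL CUTOFF:
# `R_Λ = 𝔽_S P_Λ 𝔽_S⁻¹ P_Λ = u_S P̂⁰_Λ u_S^* P_Λ` and the annulus identity `u_p^* P_Λ u_p = P_Λ + u_p^* T Q₀ η_p + Q₀ T^* η_p`

LABEL (line 1): RH-FREE literature (theorems + two abbreviating definitions with bodies; NO named fact).
bears_on: LADDER-RH W-C/W-P (C1 named-fact debt), cell `rh-crit`, sub-cell cc, overflow row O1 — green layer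
under the row's last named fact `Connes1999_thm_VII_4_rat` (the cases `P ≠ ∅`).  WHAT THIS IS NOT: any claim
about positivity, Weil's criterion or RH — operator identities between cutoffs, dilations and the Fourier
transform say nothing about zeros; nothing here bears on the truth of RH.

Sources.  A. Connes, *Trace formula in noncommutative geometry and the zeros of the Riemann zeta function*,
Selecta Math. 5 (1999) [`Connes1999`], §VII (12)–(13) (the cutoffs `P_Λ`, `P̂_Λ = F P_Λ F⁻¹`, `R_Λ = P̂_Λ P_Λ`)
and Thm VII.4 (held text `paper:arxiv-math_9811068`, p0012–p0013); A. Connes, C. Consani, H. Moscovici, *Zeta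
zeros and prolate wave operators*, Ann. Funct. Anal. 15 (2024) [`ConnesConsaniMoscovici2024`], §4.2 Prop. 4.1
(iii) (`𝔽_S ∘ η_S = η_S ∘ 𝔽_{e_ℝ}`), §4.7 Prop. 4.7 (i), (iii) (`𝔽_S ∘ θ_S = θ_S ∘ 𝔽_{e_ℝ}`,
`⟨θ_S f | η_S g⟩ = ⟨f | g⟩`) (held text `paper:arxiv-2310.18423`, p0012, p0015); A. Connes, *The Riemann
Hypothesis: past, present and a letter through time*, arXiv:2602.04022 [`Connes2026Letter`], §7.4.

## What is proved (all for the tree's pulled-back objects of `LetterSemilocal.lean` / `SemilocalTransformGeneralS.lean`)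

Write `θ_S = twistProd P`, `η_S = etaProd P`, `𝓕 = fourierL2`, `P_Λ = cutoffProj Λ` (Connes 2026 namespace),
`D_a = lpDilation a`, `ϑ(e^τ) = scalingUnitary τ`, `ϑ(g) = scalingOp g`.

* §1 Dilations versus cutoffs: `P_Λ D_a = D_a P_{Λ|a|}` (`cutoffProj_mul_lpDilation`), hence
  `P_Λ ϑ(e^τ) = ϑ(e^τ) P_{Λe^{−τ}}`, `P_Λ D_p = D_p P_{pΛ}`… and `𝓕 ϑ(e^τ) = ϑ(e^{−τ}) 𝓕`
  (`fourierL2_mul_scalingUnitary`); `ϑ(g)` commutes with every operator commuting with all `ϑ(e^τ)`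
  (`commute_scalingOp_of_forall_commute_scalingUnitary`), in particular with `θ_S`, `η_S`, `D_a`.
* §2 **The unitary `u_S := θ_S η_S`** (`twistUnitary P`; its adjoint is `η_S⁻¹ θ_S⁻¹`, `adjoint_twistUnitary`;
  `u_S ∈ unitary`, `twistUnitary_mem_unitary`) and **`𝔽_S = u_S 𝓕`** (`semilocalFourierOf_eq_twistUnitary_mul`),
  `𝓕 u_S = u_S^* 𝓕` (`fourierL2_mul_twistUnitary`); consequently the ultraviolet cutoff of Connes 1999 VII (13) is
  **`P̂_Λ^S = u_S P̂⁰_Λ u_S^*`** with `P̂⁰_Λ = dualCutoffProj ∅ Λ = 𝓕 P_Λ 𝓕⁻¹` (`dualCutoffProj_eq_conj`) and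
  **`R_Λ^S = cutoffR P Λ = u_S P̂⁰_Λ u_S^* P_Λ`** (`cutoffR_eq_conj`); the diagonal coefficient of `ϑ(g) R_Λ^S` at a
  vector `e` equals that of `ϑ(g) P̂⁰_Λ (u_S^* P_Λ u_S)` at `u_S^* e` (`diagCoeff_cutoffR_eq`).
* §3 **The annulus identity** (one prime `p`; `T := 1 − θ_p = p⁻¹D_{p⁻¹}`, `T^* = D_p = primeDilation p`,
  `η_p = semilocalEta p = (1 − D_p)⁻¹`, `Q₀ := P_Λ − P_{Λ/p}` = multiplication by `1_{Λ/p < |v| ≤ Λ}`,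
  `annulusProj p Λ`): `[P_Λ, θ_p] = T Q₀`, `[P_Λ, η_p] = η_p Q₀ D_p η_p`, and
  **`u_p^* P_Λ u_p = P_Λ + u_p^* T Q₀ η_p + Q₀ D_p η_p`** (`adjoint_twistUnitary_mul_cutoffProj_mul_twistUnitary`):
  the whole `p`-adic correction to the infrared cutoff factors through the top annulus `(Λ/p, Λ]`.
  For several primes the correction is assembled prime by prime (`cutoffCorrection_insert`).

These are the operator-algebra steps of a proof of the `P ≠ ∅` cases of `Connes1999_thm_VII_4_rat` in the
`K_S`-invariant picture (the analytic steps — nuclearity of `ϑ(g) P̂⁰_M Q₀` uniformly in `M`, and the limit —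
are not in this file).  No instance, notation or attribute; every definition has a body; no `def … : Prop`.
-/

noncomputable section

open _root_.MeasureTheory Complex Set Filter
open scoped Real Topology ComplexConjugate ENNReal InnerProductSpace

namespace Literature.NumberTheory.Connes2026

open Literature.NumberTheory.LFunctions Literature.Analysis.OperatorTheory
open Literature.NumberTheory.ConnesConsani2024
open Literature.NumberTheory.ConnesConsani2021

/-! ## §1. Dilations versus cutoffs and the Fourier transform -/

section Dilations

/-- Membership in `[−Λ, Λ]` is membership of the dilate in `[−Λ|a|, Λ|a|]` (`a ≠ 0`). [folklore] -/
private theorem mem_Icc_iff_smul_mem_Icc {a : ℝ} (ha : a ≠ 0) (Λ x : ℝ) :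
    x ∈ Icc (-Λ) Λ ↔ a • x ∈ Icc (-(Λ * |a|)) (Λ * |a|) := by
  have ha' : 0 < |a| := abs_pos.mpr ha
  rw [Set.mem_Icc, Set.mem_Icc, ← abs_le, ← abs_le, smul_eq_mul, abs_mul, mul_comm Λ |a|]
  constructor
  · intro h; exact mul_le_mul_of_nonneg_left h ha'.le
  · intro h; exact le_of_mul_le_mul_left h ha'

/-- **`P_Λ D_a = D_a P_{Λ|a|}`**: a dilation moves the infrared cutoff (`(D_a ξ)(v) = ξ(av)` is supported in
`|v| ≤ Λ` iff `ξ` is cut at `Λ|a|`).  The elementary mechanism behind the `Λ`-dependence of Connes' cutoffs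
under the scaling action (proof of Thm VII.4, eq. (29)). [cite: Connes1999, §VII eq. (12) and proof of Thm 4 eq. (29) (arXiv p0013)] -/
theorem cutoffProj_mul_lpDilation (Λ : ℝ) {a : ℝ} (ha : a ≠ 0) :
    cutoffProj Λ * lpDilation (V := ℝ) (F := ℂ) (p := (2 : ℝ≥0∞)) a ha ENNReal.ofNat_ne_top =
      lpDilation (V := ℝ) (F := ℂ) (p := (2 : ℝ≥0∞)) a ha ENNReal.ofNat_ne_top * cutoffProj (Λ * |a|) := by
  ext ξ : 1
  change cutoffProj Λ (lpDilation a ha ENNReal.ofNat_ne_top ξ) =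
    lpDilation a ha ENNReal.ofNat_ne_top (cutoffProj (Λ * |a|) ξ)
  apply Lp.ext
  filter_upwards [cutoffProj_coeFn Λ (lpDilation (V := ℝ) (F := ℂ) (p := (2 : ℝ≥0∞)) a ha
      ENNReal.ofNat_ne_top ξ),
    lpDilation_coeFn (V := ℝ) (F := ℂ) (p := (2 : ℝ≥0∞)) ha ENNReal.ofNat_ne_top ξ,
    lpDilation_coeFn (V := ℝ) (F := ℂ) (p := (2 : ℝ≥0∞)) ha ENNReal.ofNat_ne_top (cutoffProj (Λ * |a|) ξ),
    ae_eq_comp_smul (cutoffProj_coeFn (Λ * |a|) ξ) ha] with x e1 e2 e3 e4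
  rw [e1, e3, e4]
  by_cases hx : x ∈ Icc (-Λ) Λ
  · rw [Set.indicator_of_mem hx, Set.indicator_of_mem ((mem_Icc_iff_smul_mem_Icc ha Λ x).mp hx), e2]
  · rw [Set.indicator_of_notMem hx,
      Set.indicator_of_notMem (fun h => hx ((mem_Icc_iff_smul_mem_Icc ha Λ x).mpr h))]

/-- `P_Λ ϑ(e^τ) = ϑ(e^τ) P_{Λe^{−τ}}` (`ϑ(e^τ) = e^{−τ/2} D_{e^{−τ}}`). [cite: Connes1999, §VII eq. (12) and proof of Thm 4 eq. (29) (arXiv p0013)] -/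
theorem cutoffProj_mul_scalingUnitary (Λ τ : ℝ) :
    cutoffProj Λ * scalingUnitary τ = scalingUnitary τ * cutoffProj (Λ * Real.exp (-τ)) := by
  have h := cutoffProj_mul_lpDilation Λ (Real.exp_pos (-τ)).ne'
  rw [abs_of_pos (Real.exp_pos _)] at h
  change cutoffProj Λ * ((Real.exp (-τ / 2) : ℂ) • _) = ((Real.exp (-τ / 2) : ℂ) • _) * _
  rw [mul_smul_comm, smul_mul_assoc, h]

/-- `P_Λ D_p = D_p P_{pΛ}` for the dilation `D_p = primeDilation p`. [cite: ConnesConsaniMoscovici2024, Lemma 4.11 (ii) §4.2 p. 17 (arXiv chunk p0012:L104)] -/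
theorem cutoffProj_mul_primeDilation (Λ : ℝ) (p : ℕ) [hp : Fact p.Prime] :
    cutoffProj Λ * primeDilation p = primeDilation p * cutoffProj (Λ * p) := by
  have h := cutoffProj_mul_lpDilation Λ (Nat.cast_ne_zero.mpr hp.out.ne_zero : (p : ℝ) ≠ 0)
  rw [Nat.abs_cast] at h
  rw [primeDilation_eq_lpDilation]
  exact h

/-- `D_p P_Λ = P_{Λ/p} D_p`. [cite: ConnesConsaniMoscovici2024, Lemma 4.11 (ii) §4.2 p. 17 (arXiv chunk p0012:L104)] -/
theorem primeDilation_mul_cutoffProj (Λ : ℝ) (p : ℕ) [hp : Fact p.Prime] :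
    primeDilation p * cutoffProj Λ = cutoffProj (Λ / p) * primeDilation p := by
  have hp0 : (p : ℝ) ≠ 0 := Nat.cast_ne_zero.mpr hp.out.ne_zero
  rw [cutoffProj_mul_primeDilation, div_mul_cancel₀ Λ hp0]

/-- `P_Λ (1 − θ_p) = (1 − θ_p) P_{Λ/p}` (`1 − θ_p = p⁻¹ D_{p⁻¹}`). [cite: ConnesConsaniMoscovici2024, §4.6 Lemma after Def. 4.5 (ii) p. 22 (arXiv chunk p0015:L1–L5)] -/
theorem cutoffProj_mul_one_sub_primeTwist (Λ : ℝ) (p : ℕ) [hp : Fact p.Prime] :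
    cutoffProj Λ * (1 - primeTwist p) = (1 - primeTwist p) * cutoffProj (Λ / p) := by
  have hp0 : (p : ℝ) ≠ 0 := Nat.cast_ne_zero.mpr hp.out.ne_zero
  have hpos : (0 : ℝ) < p := by exact_mod_cast hp.out.pos
  have h := cutoffProj_mul_lpDilation Λ (inv_ne_zero hp0)
  rw [abs_of_pos (inv_pos.mpr hpos), ← div_eq_mul_inv] at h
  rw [primeTwist_eq_one_sub, sub_sub_cancel, mul_smul_comm, smul_mul_assoc, h]

/-- Changing the scale parameter of `lpDilation` along an equality of reals. [folklore] -/
private theorem lpDilation_congr {a b : ℝ} (h : a = b) (ha : a ≠ 0) (hb : b ≠ 0) :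
    (lpDilation (V := ℝ) (F := ℂ) (p := (2 : ℝ≥0∞)) a ha ENNReal.ofNat_ne_top :
        Lp ℂ 2 (volume : Measure ℝ) →L[ℂ] Lp ℂ 2 (volume : Measure ℝ)) =
      lpDilation (V := ℝ) (F := ℂ) (p := (2 : ℝ≥0∞)) b hb ENNReal.ofNat_ne_top := by
  subst h
  rfl

/-- **`𝓕 ϑ(e^τ) = ϑ(e^{−τ}) 𝓕`** on `L²(ℝ)` — the Fourier transform inverts dilations (`𝓕 D_c = |c|⁻¹D_{c⁻¹}𝓕`
with the unitary normalisation `e^{−τ/2}`). [cite: ConnesConsaniMoscovici2024, Prop. 4.2 (ii) §4.2 p. 18 ("`𝔽_S ϑ(λ) = ϑ(λ⁻¹) 𝔽_S`", arXiv chunk p0013:L5)] -/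
theorem fourierL2_mul_scalingUnitary (τ : ℝ) :
    fourierL2 * scalingUnitary τ = scalingUnitary (-τ) * fourierL2 := by
  ext ξ : 1
  change fourierL2 (scalingUnitary τ ξ) = scalingUnitary (-τ) (fourierL2 ξ)
  rw [scalingUnitary_apply, scalingUnitary_apply, fourierL2_eq_fourier, fourierL2_eq_fourier,
    FourierTransform.fourier_smul, fourier_lpDilation (Real.exp_pos (-τ)).ne', abs_of_pos (Real.exp_pos _),
    RCLike.real_smul_eq_coe_smul (K := ℂ), smul_smul]
  have hexp : (Real.exp (-τ))⁻¹ = Real.exp (-(-τ)) := by rw [neg_neg, Real.exp_neg, inv_inv]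
  have hcoef : (Real.exp (-τ / 2) : ℂ) * (((Real.exp (-τ))⁻¹ : ℝ) : ℂ) = (Real.exp (-(-τ) / 2) : ℂ) := by
    rw [← Complex.ofReal_mul]
    congr 1
    rw [Real.exp_neg, inv_inv, ← Real.exp_add]
    congr 1
    ring
  change ((Real.exp (-τ / 2) : ℂ) * (((Real.exp (-τ))⁻¹ : ℝ) : ℂ)) • _ = _
  rw [hcoef, lpDilation_congr hexp]

/-- **An operator commuting with every `ϑ(e^τ)` commutes with `ϑ(g) = ∫ g(τ) ϑ(e^τ) dτ`** (the Bochner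
integral commutes with bounded operators; for `g ∉ L¹` the tree's `scalingOp g` is `0`). [cite: ConnesConsani2021, Prop. 2.2 (iii) p. 10 (proof: `ϑ(f) = ∫ f(λ)ϑ(λ)d^*λ`)] -/
theorem commute_scalingOp_of_forall_commute_scalingUnitary (g : ℝ → ℂ)
    {A : Lp ℂ 2 (volume : Measure ℝ) →L[ℂ] Lp ℂ 2 (volume : Measure ℝ)}
    (hA : ∀ τ : ℝ, Commute A (scalingUnitary τ)) : Commute A (scalingOp g) := by
  by_cases hg : Integrable g
  · change A * scalingOp g = scalingOp g * A
    ext η : 1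
    change A (scalingOp g η) = scalingOp g (A η)
    rw [scalingOp_apply hg, scalingOp_apply hg,
      ← ContinuousLinearMap.integral_comp_comm A (integrable_smul_scalingUnitary hg η)]
    congr 1
    funext τ
    rw [ContinuousLinearMap.map_smul]
    congr 1
    exact congrArg (fun T : Lp ℂ 2 (volume : Measure ℝ) →L[ℂ] Lp ℂ 2 (volume : Measure ℝ) => T η)
      (hA τ).eq
  · have h0 : scalingOp g = 0 := by
      unfold scalingOp
      rw [dif_neg hg]
    rw [h0]
    exact Commute.zero_right A

/-- `ϑ(g)` commutes with every dilation `D_a`. [cite: ConnesConsaniMoscovici2024, proof of Thm. 4.1 (ii) §4.3 p. 18 ("the scaling operator commutes with `η_S`", arXiv chunk p0013:L52)] -/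
theorem commute_lpDilation_scalingOp {a : ℝ} (ha : a ≠ 0) (g : ℝ → ℂ) :
    Commute (lpDilation (V := ℝ) (F := ℂ) (p := (2 : ℝ≥0∞)) a ha ENNReal.ofNat_ne_top) (scalingOp g) :=
  commute_scalingOp_of_forall_commute_scalingUnitary g fun τ =>
    (commute_lpDilation_lpDilation ha (Real.exp_pos (-τ)).ne').smul_right _

/-- `ϑ(g)` commutes with `θ_S`. [cite: ConnesConsaniMoscovici2024, proof of Thm. 4.1 (ii) §4.3 p. 18 (arXiv chunk p0013:L52)] -/
theorem commute_twistProd_scalingOp (P : Finset ℕ) (g : ℝ → ℂ) : Commute (twistProd P) (scalingOp g) :=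
  commute_scalingOp_of_forall_commute_scalingUnitary g fun τ =>
    ((commute_lpDilation_twistProd (Real.exp_pos (-τ)).ne' P).symm).smul_right _

/-- `ϑ(g)` commutes with `η_S`. [cite: ConnesConsaniMoscovici2024, proof of Thm. 4.1 (ii) §4.3 p. 18 (arXiv chunk p0013:L52)] -/
theorem commute_etaProd_scalingOp (P : Finset ℕ) (g : ℝ → ℂ) : Commute (etaProd P) (scalingOp g) :=
  commute_scalingOp_of_forall_commute_scalingUnitary g fun τ =>
    ((commute_lpDilation_etaProd (Real.exp_pos (-τ)).ne' P).symm).smul_right _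

end Dilations

/-! ## §2. The unitary `u_S = θ_S η_S` and `𝔽_S = u_S 𝓕`, `R_Λ = u_S P̂⁰_Λ u_S^* P_Λ` -/

section TwistUnitary

/-- **The unitary part `u_S := θ_S η_S` of the twist** (`θ_S^* = η_S⁻¹`, CCM 2024 Prop. 4.7 (iii), so
`u_S^* u_S = η_S^* θ_S^* θ_S η_S = 1`): the operator by which the pulled-back Fourier transform of `𝔸_S`
differs from `𝔽_{e_ℝ}`, `𝔽_S = u_S 𝓕` (below); on the Mellin line it is the unimodular ratio of local factors
`Π_p (1 − p^{−1/2−is})/(1 − p^{−1/2+is})`. [cite: ConnesConsaniMoscovici2024, Prop. 4.7 (iii) §4.7 p. 22 and eq. (58) (arXiv chunk p0015:L37–L58)] -/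
def twistUnitary (P : Finset ℕ) : Lp ℂ 2 (volume : Measure ℝ) →L[ℂ] Lp ℂ 2 (volume : Measure ℝ) :=
  twistProd P * etaProd P

/-- Unfolding `twistUnitary`. [cite: ConnesConsaniMoscovici2024, Prop. 4.7 (iii) §4.7 p. 22 (arXiv chunk p0015:L58)] -/
theorem twistUnitary_def (P : Finset ℕ) : twistUnitary P = twistProd P * etaProd P := rfl

/-- `θ_S` commutes with `η_S⁻¹ = Π (1 − D_p)`. [cite: ConnesConsaniMoscovici2024, §4.2 eq. (44) p. 16 (commuting dilations)] -/
theorem commute_twistProd_etaInvProd (P P' : Finset ℕ) : Commute (twistProd P) (etaInvProd P') :=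
  Commute.list_prod_left _ _ fun x hx => by
    obtain ⟨m, -, rfl⟩ := List.mem_map.mp hx
    exact Commute.list_prod_right _ _ fun y hy => by
      obtain ⟨n, -, rfl⟩ := List.mem_map.mp hy
      exact commute_twistAt_etaInvAt m n

/-- `η_S` commutes with `θ_S⁻¹`. [cite: ConnesConsaniMoscovici2024, §4.2 eq. (44) p. 16 (commuting dilations)] -/
theorem commute_etaProd_twistProdUnit_inv (P : Finset ℕ) :
    Commute (etaProd P) (↑(twistProdUnit P)⁻¹ : Lp ℂ 2 (volume : Measure ℝ) →L[ℂ] Lp ℂ 2 (volume : Measure ℝ)) := by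
  have h : Commute (etaProd P) (↑(twistProdUnit P) : Lp ℂ 2 (volume : Measure ℝ) →L[ℂ] Lp ℂ 2 (volume : Measure ℝ)) := by
    rw [val_twistProdUnit]; exact (commute_twistProd_etaProd P P).symm
  exact h.units_inv_right

/-- `η_S⁻¹` commutes with `θ_S⁻¹`. [cite: ConnesConsaniMoscovici2024, §4.2 eq. (44) p. 16 (commuting dilations)] -/
theorem commute_etaInvProd_twistProdUnit_inv (P : Finset ℕ) :
    Commute (etaInvProd P) (↑(twistProdUnit P)⁻¹ : Lp ℂ 2 (volume : Measure ℝ) →L[ℂ] Lp ℂ 2 (volume : Measure ℝ)) := by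
  have h : Commute (etaInvProd P) (↑(twistProdUnit P) : Lp ℂ 2 (volume : Measure ℝ) →L[ℂ] Lp ℂ 2 (volume : Measure ℝ)) := by
    rw [val_twistProdUnit]; exact (commute_twistProd_etaInvProd P P).symm
  exact h.units_inv_right

/-- **`η_S^* = θ_S⁻¹`**: `η_S^* θ_S = 1` (adjoint form of `⟨θ_S f | η_S g⟩ = ⟨f | g⟩`, Prop. 4.7 (iii)). [cite: ConnesConsaniMoscovici2024, Prop. 4.7 (iii) §4.7 p. 22 (arXiv chunk p0015:L58)] -/
theorem adjoint_etaProd_mul_twistProd (P : Finset ℕ) :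
    ContinuousLinearMap.adjoint (etaProd P) * twistProd P = 1 := by
  ext y : 1
  change ContinuousLinearMap.adjoint (etaProd P) (twistProd P y) = y
  refine ext_inner_left ℂ fun x => ?_
  rw [ContinuousLinearMap.adjoint_inner_right, ← inner_conj_symm, inner_twistProd_etaProd, inner_conj_symm]

/-- **`η_S^* = θ_S⁻¹`.** [cite: ConnesConsaniMoscovici2024, Prop. 4.7 (iii) §4.7 p. 22 (arXiv chunk p0015:L58)] -/
theorem adjoint_etaProd (P : Finset ℕ) :
    ContinuousLinearMap.adjoint (etaProd P) =
      (↑(twistProdUnit P)⁻¹ : Lp ℂ 2 (volume : Measure ℝ) →L[ℂ] Lp ℂ 2 (volume : Measure ℝ)) := by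
  symm
  apply Units.inv_eq_of_mul_eq_one_left
  rw [val_twistProdUnit]
  exact adjoint_etaProd_mul_twistProd P

/-- **`u_S^* = θ_S⁻¹ η_S⁻¹`.** [cite: ConnesConsaniMoscovici2024, Prop. 4.7 (iii) §4.7 p. 22 (arXiv chunk p0015:L58)] -/
theorem adjoint_twistUnitary (P : Finset ℕ) :
    ContinuousLinearMap.adjoint (twistUnitary P) =
      (↑(twistProdUnit P)⁻¹ : Lp ℂ 2 (volume : Measure ℝ) →L[ℂ] Lp ℂ 2 (volume : Measure ℝ)) * etaInvProd P := by
  rw [twistUnitary_def, ← ContinuousLinearMap.star_eq_adjoint, star_mul, ContinuousLinearMap.star_eq_adjoint,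
    ContinuousLinearMap.star_eq_adjoint, adjoint_etaProd, adjoint_twistProd]

/-- `u_S^* u_S = 1`. [cite: ConnesConsaniMoscovici2024, Prop. 4.7 (iii) §4.7 p. 22 (arXiv chunk p0015:L58)] -/
theorem adjoint_twistUnitary_mul_self (P : Finset ℕ) :
    ContinuousLinearMap.adjoint (twistUnitary P) * twistUnitary P = 1 := by
  rw [adjoint_twistUnitary, twistUnitary_def]
  calc (↑(twistProdUnit P)⁻¹ : Lp ℂ 2 (volume : Measure ℝ) →L[ℂ] Lp ℂ 2 (volume : Measure ℝ)) * etaInvProd P *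
        (twistProd P * etaProd P)
      = ↑(twistProdUnit P)⁻¹ * (etaInvProd P * twistProd P) * etaProd P := by simp only [mul_assoc]
    _ = ↑(twistProdUnit P)⁻¹ * (twistProd P * etaInvProd P) * etaProd P := by
        rw [(commute_twistProd_etaInvProd P P).eq]
    _ = (↑(twistProdUnit P)⁻¹ * twistProd P) * (etaInvProd P * etaProd P) := by simp only [mul_assoc]
    _ = 1 := by rw [twistProdUnit_inv_mul, etaInvProd_mul_etaProd, mul_one]

/-- `u_S u_S^* = 1`. [cite: ConnesConsaniMoscovici2024, Prop. 4.7 (iii) §4.7 p. 22 (arXiv chunk p0015:L58)] -/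
theorem twistUnitary_mul_adjoint_self (P : Finset ℕ) :
    twistUnitary P * ContinuousLinearMap.adjoint (twistUnitary P) = 1 := by
  rw [adjoint_twistUnitary, twistUnitary_def]
  calc twistProd P * etaProd P *
        ((↑(twistProdUnit P)⁻¹ : Lp ℂ 2 (volume : Measure ℝ) →L[ℂ] Lp ℂ 2 (volume : Measure ℝ)) * etaInvProd P)
      = twistProd P * (etaProd P * ↑(twistProdUnit P)⁻¹) * etaInvProd P := by simp only [mul_assoc]
    _ = twistProd P * (↑(twistProdUnit P)⁻¹ * etaProd P) * etaInvProd P := by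
        rw [(commute_etaProd_twistProdUnit_inv P).eq]
    _ = (twistProd P * ↑(twistProdUnit P)⁻¹) * (etaProd P * etaInvProd P) := by simp only [mul_assoc]
    _ = 1 := by rw [twistProd_mul_inv, etaProd_mul_etaInvProd, mul_one]

/-- **`u_S` is a unitary of `L²(ℝ)`.** [cite: ConnesConsaniMoscovici2024, Prop. 4.7 (iii) §4.7 p. 22 (arXiv chunk p0015:L58)] -/
theorem twistUnitary_mem_unitary (P : Finset ℕ) :
    twistUnitary P ∈ unitary (Lp ℂ 2 (volume : Measure ℝ) →L[ℂ] Lp ℂ 2 (volume : Measure ℝ)) := by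
  rw [Unitary.mem_iff, ContinuousLinearMap.star_eq_adjoint]
  exact ⟨adjoint_twistUnitary_mul_self P, twistUnitary_mul_adjoint_self P⟩

/-- `u_S` preserves inner products. [cite: ConnesConsaniMoscovici2024, Prop. 4.7 (iii) §4.7 p. 22 (arXiv chunk p0015:L58)] -/
theorem inner_twistUnitary_twistUnitary (P : Finset ℕ) (ξ η : Lp ℂ 2 (volume : Measure ℝ)) :
    ⟪twistUnitary P ξ, twistUnitary P η⟫_ℂ = ⟪ξ, η⟫_ℂ := by
  rw [← ContinuousLinearMap.adjoint_inner_right, ← mul_apply_eq_comp, adjoint_twistUnitary_mul_self,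
    one_apply_eq_self]

/-- `u_S^*` preserves inner products. [cite: ConnesConsaniMoscovici2024, Prop. 4.7 (iii) §4.7 p. 22 (arXiv chunk p0015:L58)] -/
theorem inner_adjoint_twistUnitary_adjoint_twistUnitary (P : Finset ℕ) (ξ η : Lp ℂ 2 (volume : Measure ℝ)) :
    ⟪ContinuousLinearMap.adjoint (twistUnitary P) ξ, ContinuousLinearMap.adjoint (twistUnitary P) η⟫_ℂ = ⟪ξ, η⟫_ℂ := by
  rw [ContinuousLinearMap.adjoint_inner_left, ← mul_apply_eq_comp, twistUnitary_mul_adjoint_self,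
    one_apply_eq_self]

/-- `ϑ(g)` commutes with `u_S`. [cite: ConnesConsaniMoscovici2024, proof of Thm. 4.1 (ii) §4.3 p. 18 (arXiv chunk p0013:L52)] -/
theorem commute_twistUnitary_scalingOp (P : Finset ℕ) (g : ℝ → ℂ) : Commute (twistUnitary P) (scalingOp g) :=
  (commute_twistProd_scalingOp P g).mul_left (commute_etaProd_scalingOp P g)

/-- `ϑ(e^τ)` commutes with `u_S`. [cite: ConnesConsaniMoscovici2024, proof of Thm. 4.1 (ii) §4.3 p. 18 (arXiv chunk p0013:L52)] -/
theorem commute_twistUnitary_scalingUnitary (P : Finset ℕ) (τ : ℝ) :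
    Commute (twistUnitary P) (scalingUnitary τ) :=
  (((commute_lpDilation_twistProd (Real.exp_pos (-τ)).ne' P).symm).smul_right _).mul_left
    (((commute_lpDilation_etaProd (Real.exp_pos (-τ)).ne' P).symm).smul_right _)

/-- `𝓕 θ_S = η_S⁻¹ 𝓕` (factorwise `𝓕 θ_p = (1 − D_p) 𝓕`, the tree's `fourier_primeTwist`). [cite: ConnesConsaniMoscovici2024, Prop. 4.7 (i) §4.7 p. 22 (arXiv chunk p0015:L42, proof L60)] -/
theorem fourierL2_mul_twistProd (P : Finset ℕ) : fourierL2 * twistProd P = etaInvProd P * fourierL2 := by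
  induction P using Finset.induction_on with
  | empty => simp [twistProd_empty, etaInvProd, Finset.sort_empty]
  | insert a P ha ih =>
    rw [twistProd_insert ha, etaInvProd_insert ha, ← mul_assoc, mul_assoc (etaInvAt a), ← ih, ← mul_assoc]
    congr 1
    by_cases hap : a.Prime
    · haveI : Fact a.Prime := ⟨hap⟩
      rw [twistAt_of_prime, etaInvAt_of_prime]
      ext w : 1
      change fourierL2 (primeTwist a w) = (1 - primeDilation a) (fourierL2 w)
      rw [fourierL2_eq_fourier, fourierL2_eq_fourier, fourier_primeTwist]
      rfl
    · rw [twistAt_of_not_prime hap, etaInvAt_of_not_prime hap, mul_one, one_mul]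

/-- `𝓕 η_S⁻¹ = θ_S 𝓕` (factorwise `𝓕 (1 − D_p) = θ_p 𝓕`, the tree's `primeTwist_fourier`). [cite: ConnesConsaniMoscovici2024, Prop. 4.1 (iii) §4.2 p. 17 (arXiv chunk p0012:L107, proof L128)] -/
theorem fourierL2_mul_etaInvProd (P : Finset ℕ) : fourierL2 * etaInvProd P = twistProd P * fourierL2 := by
  induction P using Finset.induction_on with
  | empty => simp [twistProd_empty, etaInvProd, Finset.sort_empty]
  | insert a P ha ih =>
    rw [twistProd_insert ha, etaInvProd_insert ha, ← mul_assoc, mul_assoc (twistAt a), ← ih, ← mul_assoc]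
    congr 1
    by_cases hap : a.Prime
    · haveI : Fact a.Prime := ⟨hap⟩
      rw [twistAt_of_prime, etaInvAt_of_prime]
      ext v : 1
      change fourierL2 ((1 - primeDilation a) v) = primeTwist a (fourierL2 v)
      rw [fourierL2_eq_fourier, fourierL2_eq_fourier, primeTwist_fourier]
      rfl
    · rw [twistAt_of_not_prime hap, etaInvAt_of_not_prime hap, mul_one, one_mul]

/-- `𝓕 η_S = θ_S⁻¹ 𝓕`. [cite: ConnesConsaniMoscovici2024, Prop. 4.1 (iii) §4.2 p. 17 (arXiv chunk p0012:L107)] -/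
theorem fourierL2_mul_etaProd (P : Finset ℕ) :
    fourierL2 * etaProd P =
      (↑(twistProdUnit P)⁻¹ : Lp ℂ 2 (volume : Measure ℝ) →L[ℂ] Lp ℂ 2 (volume : Measure ℝ)) * fourierL2 := by
  calc fourierL2 * etaProd P
      = ((↑(twistProdUnit P)⁻¹ : Lp ℂ 2 (volume : Measure ℝ) →L[ℂ] Lp ℂ 2 (volume : Measure ℝ)) * twistProd P) *
          fourierL2 * etaProd P := by rw [twistProdUnit_inv_mul, one_mul]
    _ = ↑(twistProdUnit P)⁻¹ * (fourierL2 * etaInvProd P) * etaProd P := by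
        rw [fourierL2_mul_etaInvProd]; simp only [mul_assoc]
    _ = ↑(twistProdUnit P)⁻¹ * fourierL2 * (etaInvProd P * etaProd P) := by simp only [mul_assoc]
    _ = ↑(twistProdUnit P)⁻¹ * fourierL2 := by rw [etaInvProd_mul_etaProd, mul_one]

/-- **`𝓕 u_S = u_S^* 𝓕`** (the Fourier transform inverts the scaling group, so conjugates `u_S` to its adjoint). [cite: ConnesConsaniMoscovici2024, Prop. 4.2 (ii) §4.2 p. 18 ("`𝔽_S ϑ(λ) = ϑ(λ⁻¹) 𝔽_S`", arXiv chunk p0013:L5)] -/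
theorem fourierL2_mul_twistUnitary (P : Finset ℕ) :
    fourierL2 * twistUnitary P = ContinuousLinearMap.adjoint (twistUnitary P) * fourierL2 := by
  rw [adjoint_twistUnitary, twistUnitary_def, ← mul_assoc, fourierL2_mul_twistProd, mul_assoc,
    fourierL2_mul_etaProd, ← mul_assoc, (commute_etaInvProd_twistProdUnit_inv P).eq]

/-- **`𝔽_S = u_S 𝓕`**: the pulled-back Fourier transform of `𝔸_S` (`θ_S 𝓕 θ_S⁻¹`, Prop. 4.7 (i)) is Mathlib's
`𝓕` followed by the unitary `u_S = θ_S η_S`. [cite: ConnesConsaniMoscovici2024, Prop. 4.7 (i) §4.7 p. 22 (arXiv chunk p0015:L42); Connes1999, §VII Lemma 1 b) (arXiv p0012)] -/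
theorem semilocalFourierOf_eq_twistUnitary_mul (P : Finset ℕ) :
    semilocalFourierOf P = twistUnitary P * fourierL2 := by
  rw [semilocalFourierOf, twistUnitary_def]
  calc twistProd P * fourierL2 * (↑(twistProdUnit P)⁻¹ : Lp ℂ 2 (volume : Measure ℝ) →L[ℂ] Lp ℂ 2 (volume : Measure ℝ))
      = twistProd P * (etaProd P * etaInvProd P) * fourierL2 * ↑(twistProdUnit P)⁻¹ := by
        rw [etaProd_mul_etaInvProd, mul_one]
    _ = twistProd P * etaProd P * (fourierL2 * twistProd P) * ↑(twistProdUnit P)⁻¹ := by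
        rw [fourierL2_mul_twistProd]; simp only [mul_assoc]
    _ = twistProd P * etaProd P * fourierL2 * (twistProd P * ↑(twistProdUnit P)⁻¹) := by simp only [mul_assoc]
    _ = twistProd P * etaProd P * fourierL2 := by rw [twistProd_mul_inv, mul_one]

/-- The adjoint of Mathlib's `L²` Fourier transform is its inverse. [cite: ConnesConsani2021, eq. (13) p. 7] -/
theorem adjoint_fourierL2 : ContinuousLinearMap.adjoint fourierL2 = fourierL2Inv := by
  symm
  rw [ContinuousLinearMap.eq_adjoint_iff]
  intro x y
  have h := (Lp.fourierTransformₗᵢ ℝ ℂ).inner_map_map ((Lp.fourierTransformₗᵢ ℝ ℂ).symm x) y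
  rw [LinearIsometryEquiv.apply_symm_apply] at h
  exact h.symm

/-- **`𝔽_S⁻¹ = 𝓕⁻¹ u_S^* = u_S 𝓕⁻¹`.** [cite: Connes1999, §VII Lemma 1 b) (arXiv p0012)] -/
theorem semilocalFourierInvOf_eq_fourierL2Inv_mul (P : Finset ℕ) :
    semilocalFourierInvOf P = fourierL2Inv * ContinuousLinearMap.adjoint (twistUnitary P) := by
  rw [← adjoint_semilocalFourierOf, semilocalFourierOf_eq_twistUnitary_mul, ← ContinuousLinearMap.star_eq_adjoint,
    star_mul, ContinuousLinearMap.star_eq_adjoint, ContinuousLinearMap.star_eq_adjoint, adjoint_fourierL2]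

/-- `𝔽_S⁻¹ = u_S 𝓕⁻¹`. [cite: Connes1999, §VII Lemma 1 b) (arXiv p0012)] -/
theorem semilocalFourierInvOf_eq_twistUnitary_mul (P : Finset ℕ) :
    semilocalFourierInvOf P = twistUnitary P * fourierL2Inv := by
  rw [semilocalFourierInvOf_eq_fourierL2Inv_mul]
  calc fourierL2Inv * ContinuousLinearMap.adjoint (twistUnitary P)
      = fourierL2Inv * (ContinuousLinearMap.adjoint (twistUnitary P) * fourierL2) * fourierL2Inv := by
        rw [mul_assoc, mul_assoc, fourierL2_mul_fourierL2Inv, mul_one]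
    _ = (fourierL2Inv * fourierL2) * twistUnitary P * fourierL2Inv := by
        rw [← fourierL2_mul_twistUnitary]; simp only [mul_assoc]
    _ = twistUnitary P * fourierL2Inv := by rw [fourierL2Inv_mul_fourierL2, one_mul]

/-- **`P̂_Λ^S = u_S P̂⁰_Λ u_S^*`**: the ultraviolet cutoff of Connes 1999 VII (13) for `S = {∞} ∪ P` is the unitary
conjugate by `u_S` of the archimedean one `P̂⁰_Λ = 𝓕 P_Λ 𝓕⁻¹` (`dualCutoffProj ∅ Λ`). [cite: Connes1999, §VII eq. (13) (arXiv p0013); Connes2026Letter, §7.4 display (arXiv p0025:L16)] -/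
theorem dualCutoffProj_eq_conj (P : Finset ℕ) (Λ : ℝ) :
    dualCutoffProj P Λ = twistUnitary P * dualCutoffProj ∅ Λ * ContinuousLinearMap.adjoint (twistUnitary P) := by
  rw [dualCutoffProj, dualCutoffProj_empty, semilocalFourierOf_eq_twistUnitary_mul,
    semilocalFourierInvOf_eq_fourierL2Inv_mul]
  simp only [mul_assoc]

/-- **`R_Λ^S = u_S P̂⁰_Λ u_S^* P_Λ`** (`cutoffR P Λ`, Connes 1999 VII (13) `R_Λ = P̂_Λ P_Λ`). [cite: Connes1999, §VII eq. (13) (arXiv p0013)] -/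
theorem cutoffR_eq_conj (P : Finset ℕ) (Λ : ℝ) :
    cutoffR P Λ = twistUnitary P * dualCutoffProj ∅ Λ * ContinuousLinearMap.adjoint (twistUnitary P) * cutoffProj Λ := by
  rw [cutoffR, dualCutoffProj_eq_conj]

/-- **Transport of the diagonal coefficient**: `⟪e, ϑ(g) R_Λ^S e⟫ = ⟪u_S^* e, ϑ(g) P̂⁰_Λ (u_S^* P_Λ u_S) (u_S^* e)⟫`
— the diagonal series of `ϑ(g) R_Λ^S` along a Hilbert basis `(e_i)` is that of `ϑ(g) P̂⁰_Λ (u_S^* P_Λ u_S)` along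
the Hilbert basis `(u_S^* e_i)` (`ϑ(g)` commutes with `u_S`; `u_S` is unitary). [cite: Connes1999, §VII Thm 4 (arXiv p0013:L1)] -/
theorem diagCoeff_cutoffR_eq (P : Finset ℕ) (Λ : ℝ) (g : ℝ → ℂ) (e : Lp ℂ 2 (volume : Measure ℝ)) :
    diagCoeff g (cutoffR P Λ) e =
      diagCoeff g (dualCutoffProj ∅ Λ *
          (ContinuousLinearMap.adjoint (twistUnitary P) * cutoffProj Λ * twistUnitary P))
        (ContinuousLinearMap.adjoint (twistUnitary P) e) := by
  set u := twistUnitary P with hu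
  set us := ContinuousLinearMap.adjoint (twistUnitary P) with hus
  have h1 : cutoffR P Λ = u * (dualCutoffProj ∅ Λ * (us * cutoffProj Λ * u)) * us := by
    rw [cutoffR_eq_conj]
    calc twistUnitary P * dualCutoffProj ∅ Λ * ContinuousLinearMap.adjoint (twistUnitary P) * cutoffProj Λ
        = u * dualCutoffProj ∅ Λ * us * cutoffProj Λ * (u * us) := by
          rw [hu, hus, twistUnitary_mul_adjoint_self, mul_one]
      _ = u * (dualCutoffProj ∅ Λ * (us * cutoffProj Λ * u)) * us := by simp only [mul_assoc]
  unfold diagCoeff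
  rw [h1, mul_apply_eq_comp, mul_apply_eq_comp,
    ← mul_apply_eq_comp (scalingOp g) u, ← (commute_twistUnitary_scalingOp P g).eq,
    mul_apply_eq_comp, hu, ← ContinuousLinearMap.adjoint_inner_left, hus]

end TwistUnitary

/-! ## §3. The annulus identity: `u_p^* P_Λ u_p = P_Λ + u_p^* T Q₀ η_p + Q₀ D_p η_p` -/

section Annulus

variable (p : ℕ)

/-- **The top annulus `Q₀ = P_Λ − P_{Λ/p}`**: multiplication by the indicator of `Λ/p < |v| ≤ Λ` on `L²(ℝ)`
(for `Λ ≥ 0`), the shell of `C_S`-modules between `Λ/p` and `Λ` through which the `p`-adic correction to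
Connes' infrared cutoff `P_Λ` factors. [cite: Connes1999, §VII eq. (12) and proof of Thm 4 eqs. (29)–(32) (arXiv p0013)] -/
def annulusProj (Λ : ℝ) : Lp ℂ 2 (volume : Measure ℝ) →L[ℂ] Lp ℂ 2 (volume : Measure ℝ) :=
  cutoffProj Λ - cutoffProj (Λ / p)

/-- Unfolding `annulusProj`. [cite: Connes1999, §VII eq. (12) (arXiv p0013)] -/
theorem annulusProj_def (Λ : ℝ) : annulusProj p Λ = cutoffProj Λ - cutoffProj (Λ / p) := rfl

variable [hp : Fact p.Prime]

/-- **`[P_Λ, θ_p] = (1 − θ_p) Q₀`** (`1 − θ_p = p⁻¹D_{p⁻¹}` moves the cutoff from `Λ/p` to `Λ`). [cite: ConnesConsaniMoscovici2024, §4.6 Lemma after Def. 4.5 (ii) p. 22 (arXiv chunk p0015:L1–L5)] -/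
theorem cutoffProj_mul_primeTwist_sub (Λ : ℝ) :
    cutoffProj Λ * primeTwist p - primeTwist p * cutoffProj Λ = (1 - primeTwist p) * annulusProj p Λ := by
  have h := cutoffProj_mul_one_sub_primeTwist Λ p
  rw [annulusProj_def, mul_sub, ← h]
  noncomm_ring

/-- **`[P_Λ, D_p] = Q₀ D_p`** (`D_p` moves the cutoff from `Λ` to `Λ/p`). [cite: ConnesConsaniMoscovici2024, Lemma 4.11 (ii) §4.2 p. 17 (arXiv chunk p0012:L104)] -/
theorem cutoffProj_mul_primeDilation_sub (Λ : ℝ) :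
    cutoffProj Λ * primeDilation p - primeDilation p * cutoffProj Λ = annulusProj p Λ * primeDilation p := by
  rw [primeDilation_mul_cutoffProj, annulusProj_def, sub_mul]

/-- **`[P_Λ, η_p] = η_p Q₀ D_p η_p`** (`η_p = (1 − D_p)⁻¹`: `[P, A⁻¹] = −A⁻¹[P, A]A⁻¹`). [cite: ConnesConsaniMoscovici2024, §4.2 eqs. (44)–(46) pp. 16–17 (arXiv chunk p0012:L74–L94)] -/
theorem cutoffProj_mul_semilocalEta_sub (Λ : ℝ) :
    cutoffProj Λ * semilocalEta p - semilocalEta p * cutoffProj Λ =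
      semilocalEta p * annulusProj p Λ * primeDilation p * semilocalEta p := by
  have h1 := one_sub_primeDilation_mul_semilocalEta p
  have h2 := semilocalEta_mul_one_sub_primeDilation p
  have h3 := cutoffProj_mul_primeDilation_sub p Λ
  -- `P η − η P = η ((1 − D) P − P (1 − D)) η = η [P, D] η`
  calc cutoffProj Λ * semilocalEta p - semilocalEta p * cutoffProj Λ
      = (semilocalEta p * (1 - primeDilation p)) * cutoffProj Λ * semilocalEta p -
          semilocalEta p * cutoffProj Λ * ((1 - primeDilation p) * semilocalEta p) := by
        rw [h1, h2, one_mul, mul_one]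
    _ = semilocalEta p * (cutoffProj Λ * primeDilation p - primeDilation p * cutoffProj Λ) * semilocalEta p := by
        noncomm_ring
    _ = semilocalEta p * annulusProj p Λ * primeDilation p * semilocalEta p := by
        rw [h3]; simp only [mul_assoc]

/-- `u_{{p}} = θ_p η_p`. [cite: ConnesConsaniMoscovici2024, Prop. 4.7 (iii) §4.7 p. 22 (arXiv chunk p0015:L58)] -/
theorem twistUnitary_singleton : twistUnitary {p} = primeTwist p * semilocalEta p := by
  rw [twistUnitary_def, twistProd_singleton, etaProd_singleton]

/-- **The annulus identity** (the key operator-algebra step of the `P = {p}` case of Connes 1999 Thm VII.4 in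
the `K_S`-invariant picture): with `u_p = θ_pη_p`, `T = 1 − θ_p`, `Q₀ = P_Λ − P_{Λ/p}`,
`u_p^* P_Λ u_p = P_Λ + u_p^* T Q₀ η_p + Q₀ D_p η_p` — the unitary conjugate of the infrared cutoff differs from
it by two terms factoring through the top annulus `(Λ/p, Λ]`. [cite: Connes1999, §VII eqs. (12)–(13) and Thm 4 (arXiv p0013)] -/
theorem adjoint_twistUnitary_mul_cutoffProj_mul_twistUnitary (Λ : ℝ) :
    ContinuousLinearMap.adjoint (twistUnitary {p}) * cutoffProj Λ * twistUnitary {p} =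
      cutoffProj Λ +
        ContinuousLinearMap.adjoint (twistUnitary {p}) * (1 - primeTwist p) * annulusProj p Λ * semilocalEta p +
        annulusProj p Λ * primeDilation p * semilocalEta p := by
  set us := ContinuousLinearMap.adjoint (twistUnitary {p}) with hus
  have hu1 : us * twistUnitary {p} = 1 := adjoint_twistUnitary_mul_self {p}
  have hθ := cutoffProj_mul_primeTwist_sub p Λ
  have hη := cutoffProj_mul_semilocalEta_sub p Λ
  -- `P u − u P = (Pθ − θP) η + θ (Pη − ηP)`
  have hcomm : cutoffProj Λ * twistUnitary {p} - twistUnitary {p} * cutoffProj Λ =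
      (1 - primeTwist p) * annulusProj p Λ * semilocalEta p +
        twistUnitary {p} * annulusProj p Λ * primeDilation p * semilocalEta p := by
    rw [twistUnitary_singleton]
    calc cutoffProj Λ * (primeTwist p * semilocalEta p) - primeTwist p * semilocalEta p * cutoffProj Λ
        = (cutoffProj Λ * primeTwist p - primeTwist p * cutoffProj Λ) * semilocalEta p +
            primeTwist p * (cutoffProj Λ * semilocalEta p - semilocalEta p * cutoffProj Λ) := by noncomm_ring
      _ = (1 - primeTwist p) * annulusProj p Λ * semilocalEta p +
            primeTwist p * semilocalEta p * annulusProj p Λ * primeDilation p * semilocalEta p := by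
          rw [hθ, hη]; simp only [mul_assoc]
  calc us * cutoffProj Λ * twistUnitary {p}
      = us * (twistUnitary {p} * cutoffProj Λ) +
          us * (cutoffProj Λ * twistUnitary {p} - twistUnitary {p} * cutoffProj Λ) := by noncomm_ring
    _ = cutoffProj Λ + us * (1 - primeTwist p) * annulusProj p Λ * semilocalEta p +
          annulusProj p Λ * primeDilation p * semilocalEta p := by
        rw [hcomm, ← mul_assoc, hu1, one_mul, mul_add]
        simp only [← mul_assoc]
        rw [hu1, one_mul]
        abel

/-- **Assembling several primes**: writing `K_S(Λ) := u_S^* P_Λ u_S − P_Λ` for the correction, for `a ∉ P`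
one has `u_{S ∪ {a}} = u_{{a}} u_S` and `K_{S∪{a}} = K_S + u_S^* K_{{a}} u_S` — the corrections add up prime by
prime, each conjugated by a unitary commuting with the scaling action. [cite: Connes1999, §VII proof of Thm 4, eqs. (30)–(32) ("`log|u| = Σ_{v∈S} log|u_v|`", arXiv p0013)] -/
theorem cutoffCorrection_insert {a : ℕ} {P : Finset ℕ} (ha : a ∉ P) (Λ : ℝ) :
    ContinuousLinearMap.adjoint (twistUnitary (insert a P)) * cutoffProj Λ * twistUnitary (insert a P) - cutoffProj Λ =
      (ContinuousLinearMap.adjoint (twistUnitary P) * cutoffProj Λ * twistUnitary P - cutoffProj Λ) +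
        ContinuousLinearMap.adjoint (twistUnitary P) *
          (ContinuousLinearMap.adjoint (twistUnitary {a}) * cutoffProj Λ * twistUnitary {a} - cutoffProj Λ) *
          twistUnitary P := by
  have hsplit : twistUnitary (insert a P) = twistUnitary {a} * twistUnitary P := by
    rw [twistUnitary_def, twistUnitary_def, twistUnitary_def, twistProd_insert ha, etaProd_insert ha]
    have hsa : twistProd {a} = twistAt a := by simp [twistProd]
    have hea : etaProd {a} = etaAt a := by simp [etaProd]
    rw [hsa, hea]
    have hc : Commute (twistProd P) (etaAt a) := by
      rw [← hea]; exact commute_twistProd_etaProd P {a}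
    calc twistAt a * twistProd P * (etaAt a * etaProd P)
        = twistAt a * (twistProd P * etaAt a) * etaProd P := by simp only [mul_assoc]
      _ = twistAt a * (etaAt a * twistProd P) * etaProd P := by rw [hc.eq]
      _ = twistAt a * etaAt a * (twistProd P * etaProd P) := by simp only [mul_assoc]
  have hadj : ContinuousLinearMap.adjoint (twistUnitary (insert a P)) =
      ContinuousLinearMap.adjoint (twistUnitary P) * ContinuousLinearMap.adjoint (twistUnitary {a}) := by
    rw [hsplit, ← ContinuousLinearMap.star_eq_adjoint, star_mul, ContinuousLinearMap.star_eq_adjoint,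
      ContinuousLinearMap.star_eq_adjoint]
  have hu1 : ContinuousLinearMap.adjoint (twistUnitary P) * twistUnitary P = 1 := adjoint_twistUnitary_mul_self P
  rw [hadj, hsplit]
  calc ContinuousLinearMap.adjoint (twistUnitary P) * ContinuousLinearMap.adjoint (twistUnitary {a}) * cutoffProj Λ *
        (twistUnitary {a} * twistUnitary P) - cutoffProj Λ
      = ContinuousLinearMap.adjoint (twistUnitary P) *
          (ContinuousLinearMap.adjoint (twistUnitary {a}) * cutoffProj Λ * twistUnitary {a} - cutoffProj Λ) *
          twistUnitary P +
        (ContinuousLinearMap.adjoint (twistUnitary P) * cutoffProj Λ * twistUnitary P - cutoffProj Λ) := by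
        noncomm_ring
    _ = _ := by rw [add_comm]

end Annulus


end Literature.NumberTheory.Connes2026
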